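import Mathlib
import HarnessLib
import Summits.NavierStokesRegularity.FluidComputer.TriggeredTransferWitness
import Summits.NavierStokesRegularity.FluidComputer.TriggeredTransferRobust

/-!
# Door N1-FC, the closers: `CascadeGluing` in the route's own words, and the same from the
# TOLERANCE-ROBUST door predicates (`TransfersWithin`, a closing affine error budget)

Cell `ns-blowup`, seat `ns-blowup-fc-prover-1` (D-0074 GROUP C «bridge support», door N1-FC);
corollaries of this seat's cascade gluing (`TriggeredTransferWitness.lean`:
`TriggerScheme.nonempty_breakdownWitness : 0 < ν → 𝒮.Transfers ν → Nonempty (BreakdownWitness ν)`),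
stated (i) in the words of the module docstring of `TriggeredTransfer.lean` (seat `ns-blowup-fc-route`:
«the route carries `∃ 𝒮, 𝒮.Transfers 1` (the physics) and
`∀ 𝒮, 𝒮.Transfers 1 → (forced Cor. 11.4) → Nonempty (BreakdownWitness 1)` (the analysis)») — here the
analysis item is a THEOREM, and without the forced Cor. 11.4 (`cascadeGluing`); and (ii) over seat
`ns-blowup-fc-prover-2`'s tolerance-robust typing (`TriggeredTransferRobust.lean`: `TransfersWithin`,
`TransfersWithBudget`, `transfers_fatten`, `transfers_of_budget`). LABEL: E–C.
WHAT THIS IS NOT: not Navier–Stokes evidence — implications from OPEN predicates (never asserted in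
the tree) to the E–C witness type; no scheme instance is claimed; MODEL words are numerical-witness
hypotheses for these predicates, never the predicates.

* `cascadeGluing : ∀ 𝒮, 𝒮.Transfers 1 → Nonempty (BreakdownWitness 1)` and
  `navierStokesBreakdownR3_of_exists_transfers : (∃ 𝒮, 𝒮.Transfers 1) → W14 → NavierStokesBreakdownR3`
  — the TRIGGERED door is ONE open physical statement plus W14;
* `nonempty_breakdownWitness_of_transfersWithin`: `0 ≤ ρout ≤ ρin < c`, `TransfersWithin ν ρin ρout`
  (`ν > 0`) ⇒ `Nonempty (BreakdownWitness ν)` — the DNS-measurable form of the door's crux suffices;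
* `nonempty_breakdownWitness_of_budget`: an affine error budget `(amp, leak)` that closes below the
  speed floor (`amp·ρ + leak ≤ ρ < c` for some `ρ ≥ 0`) suffices;
* the same two with Tao's forced uniqueness W14 give `NavierStokesBreakdownR3` (Clay (C)).

References: T. Tao, J. Amer. Math. Soc. 29 (2016) §1.3 [cite: Tao2016AveragedNS, §1.3];
C. L. Fefferman, Clay problem (C) [cite: FeffermanClay2006, (C)]. 0 sorry; axioms ⊆ {propext,
Classical.choice, Quot.sound}.
-/

noncomputable section

namespace Summit.NavierStokesRegularity.FluidComputer.TriggeredTransfer.TriggerScheme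

open Set Filter Function
open Literature.Analysis.FluidPDE
open Summit.NavierStokesRegularity.FluidComputer.PalasekTowerClayBridge (BreakdownWitness
  navierStokesBreakdownR3_of_witness tao_unconditional_uniqueness_velocity_forced)

/-! ## The door in the route's words -/

/-- **CASCADE GLUING** (the analysis item of door N1-FC as worded in `TriggeredTransfer.lean`, at unit
viscosity, with the forced-uniqueness hypothesis REMOVED): every transferring one-shot
triggered-transfer scheme yields an exact forced blow-up of Clay class. [cite: Tao2016AveragedNS, §1.3] -/
theorem cascadeGluing : ∀ 𝒮 : TriggerScheme, 𝒮.Transfers 1 → Nonempty (BreakdownWitness 1) :=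
  fun 𝒮 hT => 𝒮.nonempty_breakdownWitness one_pos hT

/-- **The TRIGGERED door closes on Clay (C)**: the physics `∃ 𝒮, 𝒮.Transfers 1` and Tao's forced
unconditional uniqueness (W14, `tao_unconditional_uniqueness_velocity_forced`) give
`NavierStokesBreakdownR3`. [cite: FeffermanClay2006, (C)] -/
theorem navierStokesBreakdownR3_of_exists_transfers (h : ∃ 𝒮 : TriggerScheme, 𝒮.Transfers 1)
    (hU : tao_unconditional_uniqueness_velocity_forced) :
    Summit.NavierStokesRegularity.NavierStokesRegularity.NavierStokesBreakdownR3 := by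
  obtain ⟨𝒮, hT⟩ := h
  exact 𝒮.navierStokesBreakdownR3_of_transfers one_pos hT hU

/-! ## The door from the tolerance-robust predicates -/

variable (𝒮 : TriggerScheme)

/-- **Robust transfer ⇒ forced blow-up witness.** If the scheme transfers with tolerances
`0 ≤ ρout ≤ ρin < c` at viscosity `ν > 0`, then its `ρin`-fattened alphabet transfers exactly
(`transfers_fatten`) and the cascade gluing yields a `BreakdownWitness ν`. Unconditional.
[cite: Tao2016AveragedNS, §1.3] -/
theorem nonempty_breakdownWitness_of_transfersWithin {ν ρin ρout : ℝ} (hν : 0 < ν) (h0 : 0 ≤ ρout)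
    (hio : ρout ≤ ρin) (hρc : ρin < 𝒮.c) (hT : 𝒮.TransfersWithin ν ρin ρout) :
    Nonempty (BreakdownWitness ν) :=
  (𝒮.fatten ρin (h0.trans hio) hρc).nonempty_breakdownWitness hν (transfers_fatten h0 hio hρc hT)

/-- **Closing error budget ⇒ forced blow-up witness.** If the scheme transfers with an affine error
budget `(amp, leak)` (output tolerance `amp·ρ + leak` from input tolerance `ρ`) that CLOSES at some
tolerance below the floor — `amp·ρ + leak ≤ ρ`, `0 ≤ ρ < c` — then there is a `BreakdownWitness ν`
(`ν > 0`). Unconditional. [cite: Tao2016AveragedNS, §1.3] -/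
theorem nonempty_breakdownWitness_of_budget {ν amp leak ρ : ℝ} (hν : 0 < ν) (hamp : 0 ≤ amp)
    (hleak : 0 ≤ leak) (hρ0 : 0 ≤ ρ) (hρc : ρ < 𝒮.c) (hclos : amp * ρ + leak ≤ ρ)
    (h : 𝒮.TransfersWithBudget ν amp leak) : Nonempty (BreakdownWitness ν) :=
  (𝒮.fatten ρ hρ0 hρc).nonempty_breakdownWitness hν (transfers_of_budget hamp hleak hρ0 hρc hclos h)

/-- **Robust transfer + W14 ⇒ Clay (C).** [cite: FeffermanClay2006, (C)] -/
theorem navierStokesBreakdownR3_of_transfersWithin {ν ρin ρout : ℝ} (hν : 0 < ν) (h0 : 0 ≤ ρout)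
    (hio : ρout ≤ ρin) (hρc : ρin < 𝒮.c) (hT : 𝒮.TransfersWithin ν ρin ρout)
    (hU : tao_unconditional_uniqueness_velocity_forced) :
    Summit.NavierStokesRegularity.NavierStokesRegularity.NavierStokesBreakdownR3 := by
  obtain ⟨W⟩ := 𝒮.nonempty_breakdownWitness_of_transfersWithin hν h0 hio hρc hT
  exact navierStokesBreakdownR3_of_witness hν W hU

/-- **Closing error budget + W14 ⇒ Clay (C).** [cite: FeffermanClay2006, (C)] -/
theorem navierStokesBreakdownR3_of_budget {ν amp leak ρ : ℝ} (hν : 0 < ν) (hamp : 0 ≤ amp)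
    (hleak : 0 ≤ leak) (hρ0 : 0 ≤ ρ) (hρc : ρ < 𝒮.c) (hclos : amp * ρ + leak ≤ ρ)
    (h : 𝒮.TransfersWithBudget ν amp leak) (hU : tao_unconditional_uniqueness_velocity_forced) :
    Summit.NavierStokesRegularity.NavierStokesRegularity.NavierStokesBreakdownR3 := by
  obtain ⟨W⟩ := 𝒮.nonempty_breakdownWitness_of_budget hν hamp hleak hρ0 hρc hclos h
  exact navierStokesBreakdownR3_of_witness hν W hU

/-- **The door, either typing.** At a viscosity `ν > 0`, the existence of a robustly transferring
scheme (tolerances `0 ≤ ρout ≤ ρin < c`) implies a forced blow-up witness — the `∃`-form consumed by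
a route's assembly. [cite: Tao2016AveragedNS, §1.3] -/
theorem nonempty_breakdownWitness_of_exists_transfersWithin {ν : ℝ} (hν : 0 < ν)
    (h : ∃ (𝒮 : TriggerScheme) (ρin ρout : ℝ),
      0 ≤ ρout ∧ ρout ≤ ρin ∧ ρin < 𝒮.c ∧ 𝒮.TransfersWithin ν ρin ρout) :
    Nonempty (BreakdownWitness ν) := by
  obtain ⟨𝒮, ρin, ρout, h0, hio, hρc, hT⟩ := h
  exact 𝒮.nonempty_breakdownWitness_of_transfersWithin hν h0 hio hρc hT

end Summit.NavierStokesRegularity.FluidComputer.TriggeredTransfer.TriggerScheme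

end
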